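import Literature.Analysis.Distribution.ConvolutionPowerBumps
import Mathlib.Analysis.Calculus.ContDiff.Bounds
import HarnessLib

/-!
# Real slices of radial kernels built from order-adapted bumps: explicit derivative growth

Topic `Literature/Analysis/Distribution`; sequel of `ConvolutionPowerBumps`. The real slices
`x ↦ β(x² + c)` of the radial kernels `w ↦ β(|w|² − r)` on `ℂ` (`β = adaptedBump n r`, the
order-adapted bump of `ConvolutionPowerBumps`; `c = y² − r` for the slice at imaginary part `y`) are
the test functions through which the *weighted mean value property over polydiscs*
(`Literature/Analysis/Complex/PolydiscWeightedMeanValue`) converts a distributional bound into a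
pointwise bound on a holomorphic function — in Osterwalder–Schrader II (Comm. Math. Phys. 42 (1975),
Ch. VI.1, (6.4)–(6.7)) the step from E0' to the temperedness estimate (4.5) with constants of
factorial growth. This file records their derivative growth, **geometric in the order with an
explicit ratio and uniformly in the slice parameter `c`** (Faà di Bruno in the form of Mathlib's
`norm_iteratedFDeriv_comp_le` for the quadratic inner map `x ↦ x² + c`):

* `sliceFn n r c x = adaptedBump n r (x² + c)`: smooth, supported in `|x| ≤ √(max (r − c) 0)`;
* `abs_iteratedDeriv_sq_add_le` — `|(x² + c)⁽ⁱ⁾| ≤ (2|x| + 2)ⁱ` for `i ≥ 1`;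
* `abs_iteratedDeriv_sliceFn_le` — for `m ≤ n`,
  `|sliceFn⁽ᵐ⁾(x)| ≤ m! · ((n+1)/r) · max(1, (n+1)A/r)ᵐ · (2|x| + 2)ᵐ`;
* `sliceFnS` — the slice as a Schwartz function, and `seminorm_sliceFnS_le` — for `0 < r ≤ 1`,
  `−r ≤ c` and `m ≤ n`: `p_{k,m}(sliceFnS) ≤ ((n+1)/r) · 2ᵏ · (6 (n+1) max(1, (n+1)A/r))ᵐ`.

## References

* K. Osterwalder, R. Schrader, *Axioms for Euclidean Green's functions II*, Comm. Math. Phys. 42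
  (1975) 281–305, Ch. VI.1 (6.2)–(6.7). [OsterwalderSchraderCMP1975]
* L. Hörmander, *The Analysis of Linear Partial Differential Operators I*, Thm. 1.3.5, 1.4.2.
  [HormanderALPDO1]

Everything here is folklore.
-/

noncomputable section

open Set Metric Function
open scoped ContDiff Nat

namespace Literature.Analysis.Distribution

/-! ### The quadratic inner map -/

/-- Derivative of `x ↦ x² + c`. [folklore] -/
theorem deriv_sq_add (c : ℝ) : deriv (fun x : ℝ => x ^ 2 + c) = fun x => 2 * x := by
  funext y
  rw [deriv_add_const, deriv_pow_field]
  ring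

/-- Derivative of `x ↦ 2x`. [folklore] -/
theorem deriv_two_mul : deriv (fun x : ℝ => 2 * x) = fun _ => (2 : ℝ) := by
  funext y
  rw [deriv_const_mul _ differentiableAt_id, deriv_id'', mul_one]

/-- **Derivatives of the quadratic inner map**: `|(x² + c)⁽ⁱ⁾| ≤ (2|x| + 2)ⁱ` for `i ≥ 1`. [folklore] -/
theorem abs_iteratedDeriv_sq_add_le (c : ℝ) {i : ℕ} (hi : 1 ≤ i) (x : ℝ) :
    |iteratedDeriv i (fun x : ℝ => x ^ 2 + c) x| ≤ (2 * |x| + 2) ^ i := by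
  have hx : 0 ≤ |x| := abs_nonneg x
  rcases i with _ | _ | _ | i
  · omega
  · rw [iteratedDeriv_one, deriv_sq_add, pow_one, abs_mul, abs_two]
    linarith
  · rw [iteratedDeriv_succ', deriv_sq_add, iteratedDeriv_one, deriv_two_mul, abs_two]
    have h4 : (2 : ℝ) ≤ (2 * |x| + 2) ^ 2 := by nlinarith
    simpa using h4
  · rw [iteratedDeriv_succ', deriv_sq_add, iteratedDeriv_succ', deriv_two_mul, iteratedDeriv_const]
    simp only [Nat.add_eq_zero_iff, one_ne_zero, and_false, if_false, abs_zero]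
    positivity

/-- Operator-norm form of the previous bound. [folklore] -/
theorem norm_iteratedFDeriv_sq_add_le (c : ℝ) {i : ℕ} (hi : 1 ≤ i) (x : ℝ) :
    ‖iteratedFDeriv ℝ i (fun x : ℝ => x ^ 2 + c) x‖ ≤ (2 * |x| + 2) ^ i := by
  rw [norm_iteratedFDeriv_eq_norm_iteratedDeriv, Real.norm_eq_abs]
  exact abs_iteratedDeriv_sq_add_le c hi x

/-- `x ↦ x² + c` is smooth. [folklore] -/
theorem contDiff_sq_add (c : ℝ) {m : WithTop ℕ∞} : ContDiff ℝ m fun x : ℝ => x ^ 2 + c :=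
  (contDiff_id.pow 2).add contDiff_const

/-! ### The slice functions -/

/-- **The real slice** `x ↦ β(x² + c)` of the radial kernel `w ↦ β(|w|² − r)`, `β = adaptedBump n r`
(`c = y² − r` at imaginary part `y`). [cite: OsterwalderSchraderCMP1975, Ch. VI.1 (6.5)] -/
def sliceFn (n : ℕ) (r c : ℝ) (x : ℝ) : ℝ := adaptedBump n r (x ^ 2 + c)

/-- The slice is smooth. [folklore] -/
theorem contDiff_sliceFn (n : ℕ) (r c : ℝ) {m : ℕ∞} : ContDiff ℝ m (sliceFn n r c) :=
  (contDiff_adaptedBump n r).comp (contDiff_sq_add c)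

/-- The slice is nonnegative (`r > 0`). [folklore] -/
theorem sliceFn_nonneg (n : ℕ) {r : ℝ} (hr : 0 < r) (c x : ℝ) : 0 ≤ sliceFn n r c x := adaptedBump_nonneg n hr _

/-- **Support of the slice**: `sliceFn n r c x ≠ 0` forces `x² ≤ r − c`. [folklore] -/
theorem sq_le_of_sliceFn_ne_zero (n : ℕ) {r : ℝ} (hr : 0 < r) {c x : ℝ} (hx : sliceFn n r c x ≠ 0) : x ^ 2 ≤ r - c := by
  have hmem := tsupport_adaptedBump_subset n hr (subset_tsupport _ (mem_support.2 hx))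
  rw [mem_closedBall, dist_zero_right, Real.norm_eq_abs, abs_le] at hmem
  linarith [hmem.2]

/-- The topological support of the slice lies in `[−ρ, ρ]`, `ρ = √(max (r − c) 0)`. [folklore] -/
theorem tsupport_sliceFn_subset (n : ℕ) {r : ℝ} (hr : 0 < r) (c : ℝ) :
    tsupport (sliceFn n r c) ⊆ closedBall (0 : ℝ) (Real.sqrt (max (r - c) 0)) := by
  refine closure_minimal (fun x hx => ?_) isClosed_closedBall
  have h := sq_le_of_sliceFn_ne_zero n hr (mem_support.1 hx)
  rw [mem_closedBall, dist_zero_right, Real.norm_eq_abs, ← Real.sqrt_sq_eq_abs]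
  exact Real.sqrt_le_sqrt (h.trans (le_max_left _ _))

/-- The slice has compact support. [folklore] -/
theorem hasCompactSupport_sliceFn (n : ℕ) {r : ℝ} (hr : 0 < r) (c : ℝ) : HasCompactSupport (sliceFn n r c) :=
  HasCompactSupport.of_support_subset_isCompact (isCompact_closedBall (0 : ℝ) _)
    ((subset_tsupport _).trans (tsupport_sliceFn_subset n hr c))

/-- **Derivatives of the slice, geometric in the order**: for `m ≤ n`,
`|sliceFn⁽ᵐ⁾(x)| ≤ m! · ((n+1)/r) · max(1, (n+1)A/r)ᵐ · (2|x| + 2)ᵐ` (Faà di Bruno). [cite: HormanderALPDO1, Thm 1.3.5] -/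
theorem abs_iteratedDeriv_sliceFn_le (n : ℕ) {r : ℝ} (hr : 0 < r) (c : ℝ) {m : ℕ} (hm : m ≤ n) (x : ℝ) :
    |iteratedDeriv m (sliceFn n r c) x| ≤
      (m ! : ℝ) * (((n : ℝ) + 1) / r * max 1 (((n : ℝ) + 1) / r * baseDerivL1) ^ m) * (2 * |x| + 2) ^ m := by
  set ρ : ℝ := ((n : ℝ) + 1) / r with hρ
  have hρ0 : 0 < ρ := adaptedBump_ratio_pos n hr
  have hA := baseDerivL1_nonneg
  -- bounds on the outer function at the point
  have hC : ∀ i, i ≤ m → ‖iteratedFDeriv ℝ i (adaptedBump n r) (x ^ 2 + c)‖ ≤ ρ * max 1 (ρ * baseDerivL1) ^ m := by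
    intro i hi
    rw [norm_iteratedFDeriv_eq_norm_iteratedDeriv, Real.norm_eq_abs]
    refine (abs_iteratedDeriv_adaptedBump_le n hr (hi.trans hm) _).trans ?_
    rw [← hρ, pow_succ', mul_assoc, ← mul_pow]
    refine mul_le_mul_of_nonneg_left ?_ hρ0.le
    exact (pow_le_pow_left₀ (by positivity) (le_max_right 1 _) i).trans (pow_le_pow_right₀ (le_max_left _ _) hi)
  have hD : ∀ i, 1 ≤ i → i ≤ m → ‖iteratedFDeriv ℝ i (fun x : ℝ => x ^ 2 + c) x‖ ≤ (2 * |x| + 2) ^ i :=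
    fun i hi _ => norm_iteratedFDeriv_sq_add_le c hi x
  have h := norm_iteratedFDeriv_comp_le (g := adaptedBump n r) (f := fun x : ℝ => x ^ 2 + c) (n := m) (N := (m : ℕ∞))
    (contDiff_adaptedBump n r) (contDiff_sq_add c) le_rfl x hC hD
  rw [norm_iteratedFDeriv_eq_norm_iteratedDeriv, Real.norm_eq_abs] at h
  exact h

/-! ### The slices as Schwartz functions -/

/-- `m! ≤ (n+1)ᵐ` for `m ≤ n`. [folklore] -/
theorem factorial_le_pow_of_le {m n : ℕ} (h : m ≤ n) : (m ! : ℝ) ≤ ((n : ℝ) + 1) ^ m := by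
  induction m with
  | zero => simp
  | succ m ih =>
    rw [Nat.factorial_succ, Nat.cast_mul, pow_succ]
    have h1 := ih (Nat.le_of_succ_le h)
    have h2 : ((m + 1 : ℕ) : ℝ) ≤ (n : ℝ) + 1 := by exact_mod_cast Nat.succ_le_succ (Nat.le_of_succ_le h)
    calc ((m + 1 : ℕ) : ℝ) * (m ! : ℝ) ≤ ((n : ℝ) + 1) * ((n : ℝ) + 1) ^ m :=
          mul_le_mul h2 h1 (by positivity) (by positivity)
      _ = ((n : ℝ) + 1) ^ m * ((n : ℝ) + 1) := by ring

/-- **The slice as a Schwartz function** (`r > 0`). [folklore] -/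
def sliceFnS (n : ℕ) {r : ℝ} (hr : 0 < r) (c : ℝ) : SchwartzMap ℝ ℝ :=
  (hasCompactSupport_sliceFn n hr c).toSchwartzMap (contDiff_sliceFn n r c)

/-- Values of the Schwartz slice. [folklore] -/
@[simp] theorem sliceFnS_apply (n : ℕ) {r : ℝ} (hr : 0 < r) (c x : ℝ) : sliceFnS n hr c x = sliceFn n r c x := rfl

/-- **Schwartz seminorms of the slices, geometric in the order, uniformly in the slice parameter**:
for `0 < r ≤ 1`, `−r ≤ c` and `m ≤ n`,
`p_{k,m}(sliceFnS) ≤ ((n+1)/r) · 2ᵏ · (6 (n+1) max(1, (n+1)A/r))ᵐ`. [cite: OsterwalderSchraderCMP1975, Ch. VI.1 (6.12), (6.17)] -/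
theorem seminorm_sliceFnS_le (n : ℕ) {r : ℝ} (hr : 0 < r) (hr1 : r ≤ 1) {c : ℝ} (hc : -r ≤ c) (k : ℕ) {m : ℕ} (hm : m ≤ n) :
    SchwartzMap.seminorm ℝ k m (sliceFnS n hr c) ≤
      ((n : ℝ) + 1) / r * 2 ^ k * (6 * ((n : ℝ) + 1) * max 1 (((n : ℝ) + 1) / r * baseDerivL1)) ^ m := by
  have hA := baseDerivL1_nonneg
  have hρ0 : 0 < ((n : ℝ) + 1) / r := adaptedBump_ratio_pos n hr
  refine SchwartzMap.seminorm_le_bound ℝ k m _ (by positivity) fun x => ?_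
  rw [norm_iteratedFDeriv_eq_norm_iteratedDeriv, Real.norm_eq_abs, Real.norm_eq_abs]
  change |x| ^ k * |iteratedDeriv m (sliceFn n r c) x| ≤ _
  by_cases hx : x ∈ tsupport (sliceFn n r c)
  · -- on the support `|x| ≤ √(2r) ≤ 2`
    have hx2 : |x| ≤ 2 := by
      have h := tsupport_sliceFn_subset n hr c hx
      rw [mem_closedBall, dist_zero_right, Real.norm_eq_abs] at h
      refine h.trans ?_
      rw [Real.sqrt_le_left (by norm_num)]
      refine max_le ?_ (by norm_num)
      linarith
    have hder := abs_iteratedDeriv_sliceFn_le n hr c hm x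
    have hfac := factorial_le_pow_of_le hm
    have h1 : |x| ^ k ≤ 2 ^ k := pow_le_pow_left₀ (abs_nonneg _) hx2 k
    have h2 : (2 * |x| + 2) ^ m ≤ 6 ^ m := pow_le_pow_left₀ (by positivity) (by linarith) m
    set Q := max 1 (((n : ℝ) + 1) / r * baseDerivL1) with hQ
    have hQ1 : 1 ≤ Q := le_max_left _ _
    calc |x| ^ k * |iteratedDeriv m (sliceFn n r c) x|
        ≤ 2 ^ k * ((m ! : ℝ) * (((n : ℝ) + 1) / r * Q ^ m) * (2 * |x| + 2) ^ m) :=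
          mul_le_mul h1 hder (abs_nonneg _) (by positivity)
      _ ≤ 2 ^ k * ((((n : ℝ) + 1) ^ m) * (((n : ℝ) + 1) / r * Q ^ m) * 6 ^ m) := by
          gcongr
      _ = ((n : ℝ) + 1) / r * 2 ^ k * (6 * ((n : ℝ) + 1) * Q) ^ m := by
          rw [mul_pow, mul_pow]; ring
  · have h0 : iteratedDeriv m (sliceFn n r c) x = 0 :=
      image_eq_zero_of_notMem_tsupport fun h => hx (tsupport_iteratedDeriv_subset' m h)
    rw [h0, abs_zero, mul_zero]
    positivity

end Literature.Analysis.Distribution
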